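import Mathlib.Analysis.Calculus.Deriv.Add
import Mathlib.Analysis.Calculus.Deriv.Inv
import Mathlib.Analysis.Calculus.Deriv.Pow
import Mathlib.Analysis.Calculus.Deriv.Mul
import Mathlib.Topology.Order.OrderClosedExtr
import Mathlib.Analysis.SpecialFunctions.Pow.Real
import HarnessLib

/-!
# SHEET-ℝ: regularised polynomial weights `θ_ε = (1+ξ²)^{k+1}/(1+εξ²)^{k+2}` for weighted energy estimates

HONEST FRAMING (cell ns-blowup GROUP B / zone Z3, case Z3-SR-SPEC item (P6b) «the T-shift mode lies in the energy space»;
1-D MODEL calculus; not Euler, not NS). Pure real analysis of a one-parameter family of weights; nothing about any profile.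

For the weighted energy (a priori) estimates of the 1-D similarity-variable operator `νΨ″ − ½ξΨ′ − κΨ`
(`SheetRWeightedGain.lean`) one integrates by parts on the whole line against a BOUNDED weight and lets the weight increase to
`(1+ξ²)^{k+1}`. This file provides the family, for `k : ℕ` and `ε ≥ 0`:

  `gw k ε ξ = (1 + ξ²)^(k+1) / (1 + ε ξ²)^(k+2)`,   `gwl k ε ξ = 2(k+1)ξ/(1+ξ²) − 2(k+2)εξ/(1+εξ²)` (its logarithmic derivative),

with: `gw > 0`; `(gw)′ = gw · gwl` (`hasDerivAt_gw`); `gw ≤ (1+ξ²)^{k+1}` and `gw/(1+ξ²) ≤ (1+ξ²)^k`; for `0 < ε ≤ 1` the bounds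
`gw ≤ ε^{-(k+1)}`, `ξ²·gw ≤ ε^{-(k+2)}` (so `gw`, `ξ·gw`, `ξ²·gw` are bounded functions); the DRIFT inequality
`ξ · gwl ≤ 2(k+1)` (one-sided, all `ε ≥ 0` — what makes the `½ξ∂_ξ` term harmless up to the threshold `κ > (2k+3)/4`);
the derivative bound `gwl² · (1+ξ²) ≤ Dsq k := 8(k+1)² + 32(k+2)²` for `0 ≤ ε ≤ 1` (so `|θ′| ≲ θ/⟨ξ⟩`, uniformly in `ε`);
continuity in `ξ`; and `gw k ε ξ → (1+ξ²)^{k+1}` as `ε → 0⁺`. The last section is the POINTWISE ALGEBRA of the weighted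
energy identity for `νΨ″ = (½ξ + b)Ψ′ + (κ + c)Ψ + g` (`key_pointwise`: drift + AM-GM/Cauchy–Schwarz bookkeeping with the gap
`δ = κ − (2k+3)/4`; `coeff_bound`: the compact/tail split of the small coefficients). MODEL-support calculus; [folklore].
-/

noncomputable section

namespace Summit.NavierStokesRegularity.OSWSelfSimilar
namespace SheetRGainWeights

open _root_.Set _root_.Filter
open scoped Topology

/-- The regularised weight `θ_ε(ξ) = (1 + ξ²)^(k+1) / (1 + ε ξ²)^(k+2)`. [folklore] -/
def gw (k : ℕ) (ε ξ : ℝ) : ℝ := (1 + ξ ^ 2) ^ (k + 1) / (1 + ε * ξ ^ 2) ^ (k + 2)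

/-- Its logarithmic derivative `θ_ε′/θ_ε = 2(k+1)ξ/(1+ξ²) − 2(k+2)εξ/(1+εξ²)`. [folklore] -/
def gwl (k : ℕ) (ε ξ : ℝ) : ℝ :=
  2 * (k + 1) * ξ / (1 + ξ ^ 2) - 2 * (k + 2) * ε * ξ / (1 + ε * ξ ^ 2)

/-- The uniform constant in `gwl² (1+ξ²) ≤ Dsq k` (`0 ≤ ε ≤ 1`). [folklore] -/
def Dsq (k : ℕ) : ℝ := 8 * (k + 1) ^ 2 + 32 * (k + 2) ^ 2

variable {k : ℕ} {ε ξ : ℝ}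

/-- `0 < 1 + ξ²`. [folklore] -/
private lemma one_add_sq_pos (ξ : ℝ) : 0 < 1 + ξ ^ 2 := by positivity

/-- `0 < 1 + εξ²` for `ε ≥ 0`. [folklore] -/
private lemma one_add_eps_sq_pos (hε : 0 ≤ ε) (ξ : ℝ) : 0 < 1 + ε * ξ ^ 2 := by positivity

/-- `θ_ε > 0`. [folklore] -/
theorem gw_pos (hε : 0 ≤ ε) : 0 < gw k ε ξ := by
  unfold gw
  exact div_pos (pow_pos (one_add_sq_pos ξ) _) (pow_pos (one_add_eps_sq_pos hε ξ) _)

/-- `0 ≤ Dsq k`. [folklore] -/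
theorem Dsq_nonneg : 0 ≤ Dsq k := by unfold Dsq; positivity

/-- `θ_ε ≤ (1+ξ²)^{k+1}` (the denominator is `≥ 1`). [folklore] -/
theorem gw_le_pow (hε : 0 ≤ ε) : gw k ε ξ ≤ (1 + ξ ^ 2) ^ (k + 1) := by
  unfold gw
  have hD : 1 ≤ (1 + ε * ξ ^ 2) ^ (k + 2) := one_le_pow₀ (by nlinarith [sq_nonneg ξ])
  exact div_le_self (pow_nonneg (one_add_sq_pos ξ).le _) hD

/-- `θ_ε/(1+ξ²) ≤ (1+ξ²)^k`. [folklore] -/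
theorem gw_div_le_pow (hε : 0 ≤ ε) : gw k ε ξ / (1 + ξ ^ 2) ≤ (1 + ξ ^ 2) ^ k := by
  rw [div_le_iff₀ (one_add_sq_pos ξ), ← pow_succ]
  exact gw_le_pow hε

/-- For `0 < ε ≤ 1`: `θ_ε ≤ ε^{-(k+1)}` — the weight is a bounded function. [folklore] -/
theorem gw_le_inv_pow (hε : 0 < ε) (hε1 : ε ≤ 1) : gw k ε ξ ≤ (1 / ε) ^ (k + 1) := by
  unfold gw
  have hA : 0 < 1 + ε * ξ ^ 2 := one_add_eps_sq_pos hε.le ξ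
  -- `(1+ξ²) ≤ (1/ε)(1+εξ²)` and `(1+εξ²)^(k+2) ≥ (1+εξ²)^(k+1)`
  have h1 : 1 + ξ ^ 2 ≤ (1 / ε) * (1 + ε * ξ ^ 2) := by
    rw [div_mul_eq_mul_div, one_mul, le_div_iff₀ hε]
    nlinarith [sq_nonneg ξ]
  have h2 : (1 + ξ ^ 2) ^ (k + 1) ≤ ((1 / ε) * (1 + ε * ξ ^ 2)) ^ (k + 1) :=
    pow_le_pow_left₀ (one_add_sq_pos ξ).le h1 _
  have h3 : (1 + ε * ξ ^ 2) ^ (k + 1) ≤ (1 + ε * ξ ^ 2) ^ (k + 2) :=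
    pow_le_pow_right₀ (by nlinarith [sq_nonneg ξ]) (by omega)
  calc (1 + ξ ^ 2) ^ (k + 1) / (1 + ε * ξ ^ 2) ^ (k + 2)
      ≤ ((1 / ε) * (1 + ε * ξ ^ 2)) ^ (k + 1) / (1 + ε * ξ ^ 2) ^ (k + 1) := by
        gcongr
    _ = (1 / ε) ^ (k + 1) := by
        rw [mul_pow, mul_div_assoc, div_self (pow_ne_zero _ hA.ne'), mul_one]

/-- For `0 < ε ≤ 1`: `ξ²·θ_ε ≤ ε^{-(k+2)}` — so `ξ θ_ε` and `ξ² θ_ε` are bounded too. [folklore] -/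
theorem sq_mul_gw_le (hε : 0 < ε) (hε1 : ε ≤ 1) : ξ ^ 2 * gw k ε ξ ≤ (1 / ε) ^ (k + 2) := by
  have hA : 0 < 1 + ε * ξ ^ 2 := one_add_eps_sq_pos hε.le ξ
  -- `ξ² θ = [ξ²/(1+εξ²)] · [(1+ξ²)^(k+1)/(1+εξ²)^(k+1)]`
  have hsplit : ξ ^ 2 * gw k ε ξ =
      (ξ ^ 2 / (1 + ε * ξ ^ 2)) * ((1 + ξ ^ 2) ^ (k + 1) / (1 + ε * ξ ^ 2) ^ (k + 1)) := by
    unfold gw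
    rw [pow_succ (1 + ε * ξ ^ 2) (k + 1)]
    field_simp
  have h1 : ξ ^ 2 / (1 + ε * ξ ^ 2) ≤ 1 / ε := by
    rw [div_le_div_iff₀ hA hε]
    nlinarith [sq_nonneg ξ]
  have h2 : (1 + ξ ^ 2) ^ (k + 1) / (1 + ε * ξ ^ 2) ^ (k + 1) ≤ (1 / ε) ^ (k + 1) := by
    rw [← div_pow]
    refine pow_le_pow_left₀ (div_nonneg (one_add_sq_pos ξ).le hA.le) ?_ _
    rw [div_le_div_iff₀ hA hε]
    nlinarith [sq_nonneg ξ]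
  rw [hsplit, pow_succ' (1 / ε) (k + 1)]
  exact mul_le_mul h1 h2 (div_nonneg (pow_nonneg (one_add_sq_pos ξ).le _) (pow_nonneg hA.le _))
    (by positivity)

/-- `|ξ|·θ_ε ≤ ε^{-(k+1)} + ε^{-(k+2)}` for `0 < ε ≤ 1`. [folklore] -/
theorem abs_mul_gw_le (hε : 0 < ε) (hε1 : ε ≤ 1) :
    |ξ| * gw k ε ξ ≤ (1 / ε) ^ (k + 1) + (1 / ε) ^ (k + 2) := by
  have hθ := (gw_pos (k := k) (ξ := ξ) hε.le).le
  have h1 : |ξ| ≤ 1 + ξ ^ 2 := by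
    cases le_or_gt 0 ξ with
    | inl h => rw [abs_of_nonneg h]; nlinarith [sq_nonneg (ξ - 1)]
    | inr h => rw [abs_of_neg h]; nlinarith [sq_nonneg (ξ + 1)]
  calc |ξ| * gw k ε ξ ≤ (1 + ξ ^ 2) * gw k ε ξ := mul_le_mul_of_nonneg_right h1 hθ
    _ = gw k ε ξ + ξ ^ 2 * gw k ε ξ := by ring
    _ ≤ (1 / ε) ^ (k + 1) + (1 / ε) ^ (k + 2) := add_le_add (gw_le_inv_pow hε hε1) (sq_mul_gw_le hε hε1)

/-- **The drift inequality** `ξ · θ_ε′/θ_ε ≤ 2(k+1)` (all `ε ≥ 0`): the regularising factor only decreases the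
logarithmic growth. [folklore] -/
theorem id_mul_gwl_le (hε : 0 ≤ ε) : ξ * gwl k ε ξ ≤ 2 * (k + 1) := by
  unfold gwl
  have hP := one_add_sq_pos ξ
  have hA := one_add_eps_sq_pos hε ξ
  have h1 : ξ * (2 * (k + 1) * ξ / (1 + ξ ^ 2)) ≤ 2 * (k + 1) := by
    rw [mul_div_assoc', div_le_iff₀ hP]
    nlinarith [sq_nonneg ξ, (show (0:ℝ) ≤ k from Nat.cast_nonneg k)]
  have h2 : 0 ≤ ξ * (2 * (k + 2) * ε * ξ / (1 + ε * ξ ^ 2)) := by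
    rw [mul_div_assoc']
    apply div_nonneg _ hA.le
    have hk : (0:ℝ) ≤ k := Nat.cast_nonneg k
    have : ξ * (2 * (k + 2) * ε * ξ) = 2 * (k + 2) * ε * ξ ^ 2 := by ring
    rw [this]
    positivity
  rw [mul_sub]
  linarith

/-- Auxiliary: `ε² ξ² (1 + ξ²) ≤ 4 (1 + ε ξ²)²` for `0 ≤ ε ≤ 1`. [folklore] -/
lemma eps_sq_mul_le (hε0 : 0 ≤ ε) (hε1 : ε ≤ 1) (ξ : ℝ) :
    ε ^ 2 * ξ ^ 2 * (1 + ξ ^ 2) ≤ 4 * (1 + ε * ξ ^ 2) ^ 2 := by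
  have h1 : ε ^ 2 * ξ ^ 2 ≤ ε * ξ ^ 2 := by nlinarith [sq_nonneg ξ, mul_nonneg hε0 (sq_nonneg ξ)]
  nlinarith [sq_nonneg ξ, mul_nonneg hε0 (sq_nonneg ξ), sq_nonneg (ε * ξ ^ 2)]

/-- **Derivative bound** `gwl² · (1+ξ²) ≤ Dsq k` for `0 ≤ ε ≤ 1` (so `|θ′| ≤ √Dsq · θ/⟨ξ⟩`, uniformly in `ε`). [folklore] -/
theorem gwl_sq_mul_le (hε0 : 0 ≤ ε) (hε1 : ε ≤ 1) : gwl k ε ξ ^ 2 * (1 + ξ ^ 2) ≤ Dsq k := by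
  unfold gwl Dsq
  have hP := one_add_sq_pos ξ
  have hA := one_add_eps_sq_pos hε0 ξ
  set p : ℝ := 2 * (k + 1) * ξ / (1 + ξ ^ 2) with hp
  set q : ℝ := 2 * (k + 2) * ε * ξ / (1 + ε * ξ ^ 2) with hq
  -- `p² (1+ξ²) ≤ 4(k+1)²` and `q² (1+ξ²) ≤ 16(k+2)²`
  have hk : (0:ℝ) ≤ k := Nat.cast_nonneg k
  have h1 : p ^ 2 * (1 + ξ ^ 2) ≤ 4 * (k + 1) ^ 2 := by
    have : p ^ 2 * (1 + ξ ^ 2) = 4 * (k + 1) ^ 2 * (ξ ^ 2 / (1 + ξ ^ 2)) := by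
      rw [hp]; field_simp; ring
    rw [this]
    have h3 : ξ ^ 2 / (1 + ξ ^ 2) ≤ 1 := by rw [div_le_one hP]; linarith [sq_nonneg ξ]
    nlinarith [h3]
  have h2 : q ^ 2 * (1 + ξ ^ 2) ≤ 16 * (k + 2) ^ 2 := by
    have : q ^ 2 * (1 + ξ ^ 2) =
        4 * (k + 2) ^ 2 * (ε ^ 2 * ξ ^ 2 * (1 + ξ ^ 2) / (1 + ε * ξ ^ 2) ^ 2) := by
      rw [hq]; field_simp; ring
    rw [this]
    have h3 : ε ^ 2 * ξ ^ 2 * (1 + ξ ^ 2) / (1 + ε * ξ ^ 2) ^ 2 ≤ 4 := by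
      rw [div_le_iff₀ (pow_pos hA 2)]
      exact eps_sq_mul_le hε0 hε1 ξ
    nlinarith [h3]
  have h3 : (p - q) ^ 2 ≤ 2 * p ^ 2 + 2 * q ^ 2 := by nlinarith [sq_nonneg (p + q)]
  nlinarith [h3, hP.le, mul_nonneg (sq_nonneg p) hP.le, mul_nonneg (sq_nonneg q) hP.le]

/-- Consequence: `θ_ε · gwl² ≤ Dsq k · (1+ξ²)^k` (`0 ≤ ε ≤ 1`) — the bound on `θ′²/θ` used with Cauchy–Schwarz.
[folklore] -/
theorem gw_mul_gwl_sq_le (hε0 : 0 ≤ ε) (hε1 : ε ≤ 1) :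
    gw k ε ξ * gwl k ε ξ ^ 2 ≤ Dsq k * (1 + ξ ^ 2) ^ k := by
  have hP := one_add_sq_pos ξ
  have h1 := gwl_sq_mul_le (k := k) (ξ := ξ) hε0 hε1
  have h2 := gw_div_le_pow (k := k) (ξ := ξ) hε0
  have hθ := (gw_pos (k := k) (ξ := ξ) hε0).le
  -- `θ gwl² = (θ/(1+ξ²)) · (gwl² (1+ξ²))`
  have : gw k ε ξ * gwl k ε ξ ^ 2 = (gw k ε ξ / (1 + ξ ^ 2)) * (gwl k ε ξ ^ 2 * (1 + ξ ^ 2)) := by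
    field_simp
  rw [this, mul_comm (Dsq k)]
  exact mul_le_mul h2 h1 (by positivity) (pow_nonneg hP.le _)

/-- `|gwl| ≤ 1 + Dsq k` (crude; `0 ≤ ε ≤ 1`): the logarithmic derivative is a bounded function. [folklore] -/
theorem abs_gwl_le (hε0 : 0 ≤ ε) (hε1 : ε ≤ 1) : |gwl k ε ξ| ≤ 1 + Dsq k := by
  have h1 := gwl_sq_mul_le (k := k) (ξ := ξ) hε0 hε1
  have h2 : gwl k ε ξ ^ 2 ≤ Dsq k := by
    nlinarith [h1, sq_nonneg (gwl k ε ξ), sq_nonneg ξ, mul_nonneg (sq_nonneg (gwl k ε ξ)) (sq_nonneg ξ)]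
  cases le_or_gt 0 (gwl k ε ξ) with
  | inl h => rw [abs_of_nonneg h]; nlinarith [sq_nonneg (gwl k ε ξ - 1)]
  | inr h => rw [abs_of_neg h]; nlinarith [sq_nonneg (gwl k ε ξ + 1)]

/-- `|ξ · gwl| ≤ 1 + Dsq k` (`0 ≤ ε ≤ 1`). [folklore] -/
theorem abs_id_mul_gwl_le (hε0 : 0 ≤ ε) (hε1 : ε ≤ 1) : |ξ * gwl k ε ξ| ≤ 1 + Dsq k := by
  have h1 := gwl_sq_mul_le (k := k) (ξ := ξ) hε0 hε1
  have h2 : (ξ * gwl k ε ξ) ^ 2 ≤ Dsq k := by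
    nlinarith [h1, sq_nonneg (gwl k ε ξ)]
  set t := ξ * gwl k ε ξ
  cases le_or_gt 0 t with
  | inl h => rw [abs_of_nonneg h]; nlinarith [sq_nonneg (t - 1)]
  | inr h => rw [abs_of_neg h]; nlinarith [sq_nonneg (t + 1)]

/-- **Derivative of the weight**: `(θ_ε)′ = θ_ε · gwl` (`ε ≥ 0`). [folklore] -/
theorem hasDerivAt_gw (hε : 0 ≤ ε) (ξ : ℝ) : HasDerivAt (gw k ε) (gw k ε ξ * gwl k ε ξ) ξ := by
  have hP := one_add_sq_pos ξ
  have hA := one_add_eps_sq_pos hε ξ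
  have hsq : HasDerivAt (fun x : ℝ => x ^ 2) (2 * ξ) ξ := by
    simpa using hasDerivAt_pow 2 ξ
  have hN : HasDerivAt (fun x : ℝ => (1 + x ^ 2) ^ (k + 1))
      ((k + 1 : ℕ) * (1 + ξ ^ 2) ^ (k + 1 - 1) * (2 * ξ)) ξ :=
    (HasDerivAt.const_add (1 : ℝ) hsq).fun_pow (k + 1)
  have hD : HasDerivAt (fun x : ℝ => (1 + ε * x ^ 2) ^ (k + 2))
      ((k + 2 : ℕ) * (1 + ε * ξ ^ 2) ^ (k + 2 - 1) * (ε * (2 * ξ))) ξ :=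
    (HasDerivAt.const_add (1 : ℝ) (hsq.const_mul ε)).fun_pow (k + 2)
  have h := hN.fun_div hD (pow_ne_zero _ hA.ne')
  have hfun : (fun x : ℝ => (1 + x ^ 2) ^ (k + 1) / (1 + ε * x ^ 2) ^ (k + 2)) = gw k ε := by
    funext x; rfl
  rw [hfun] at h
  refine h.congr_deriv ?_
  rw [show k + 1 - 1 = k from rfl, show k + 2 - 1 = k + 1 from rfl]
  push_cast
  unfold gw gwl
  field_simp
  ring

/-- The weight is continuous in `ξ` (`ε ≥ 0`). [folklore] -/
theorem continuous_gw (hε : 0 ≤ ε) : Continuous (gw k ε) := by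
  unfold gw
  exact Continuous.div (by fun_prop) (by fun_prop) fun ξ => pow_ne_zero _ (one_add_eps_sq_pos hε ξ).ne'

/-- The logarithmic derivative is continuous in `ξ` (`ε ≥ 0`). [folklore] -/
theorem continuous_gwl (hε : 0 ≤ ε) : Continuous (gwl k ε) := by
  unfold gwl
  refine Continuous.sub ?_ ?_
  · exact Continuous.div (by fun_prop) (by fun_prop) fun ξ => (one_add_sq_pos ξ).ne'
  · exact Continuous.div (by fun_prop) (by fun_prop) fun ξ => (one_add_eps_sq_pos hε ξ).ne'

/-- **Removal of the regularisation**: `θ_ε(ξ) → (1+ξ²)^{k+1}` as `ε → 0⁺` (indeed as `ε → 0`). [folklore] -/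
theorem tendsto_gw_nhdsGT_zero (ξ : ℝ) :
    Tendsto (fun ε => gw k ε ξ) (𝓝[>] 0) (𝓝 ((1 + ξ ^ 2) ^ (k + 1))) := by
  have hcont : ContinuousAt (fun ε : ℝ => gw k ε ξ) 0 := by
    unfold gw
    refine ContinuousAt.div (by fun_prop) (by fun_prop) ?_
    simp
  have h0 : gw k 0 ξ = (1 + ξ ^ 2) ^ (k + 1) := by simp [gw]
  rw [← h0]
  exact hcont.tendsto.mono_left nhdsWithin_le_nhds

/-! ### The pointwise algebra of the weighted energy identity (used by `SheetRWeightedGain`) -/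

/-- **Key pointwise inequality.** Point values: `θ > 0` the weight, `ℓ = θ′/θ`, `Ψ₀, Ψ₁, Ψ₂ = Ψ, Ψ′, Ψ″`, `b₀, b₁ = b, b′`,
`c₀, g₀ = c, g` at `ξ`; `P₀ = (1+ξ²)^k ≥ 1`, `P₁ = (1+ξ²)^{k+1}`. Under the equation, the drift inequality
`ξℓ ≤ 2(k+1)`, `θℓ² ≤ D·P₀`, `θ ≤ P₁`, `|b₀| ≤ B₀` and the coefficient bound `(|b₁|/2 + |c₀|)θ ≤ (δ/4)θ + M₁`:
`(ν/2)θΨ₁² + (3δ/8)θΨ₀² ≤ Λ + ν·F₁′ − ½·F₂′`, where `F₁′ = θℓΨ₀Ψ₁ + θΨ₁² + θΨ₀Ψ₂` and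
`F₂′ = (½ + b₁)θΨ₀² + (½ξ + b₀)θℓΨ₀² + 2(½ξ + b₀)θΨ₀Ψ₁` are the point values of the derivatives of `θΨΨ′` and
`(½ξ + b)θΨ²`, and `Λ = (M₁ + B₀²D/(2δ) + νD/2)·P₀Ψ₀² + (2/δ)·P₁g₀²`. [folklore] -/
theorem key_pointwise {ν δ kR θ ℓ ξ Ψ₀ Ψ₁ Ψ₂ b₀ b₁ c₀ g₀ B₀ M₁ D P₀ P₁ : ℝ}
    (hν : 0 < ν) (hδ : 0 < δ) (hθ : 0 < θ) (hP₀ : 1 ≤ P₀) (hM₁ : 0 ≤ M₁)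
    (hEq : ν * Ψ₂ = (ξ / 2 + b₀) * Ψ₁ + (δ + (2 * kR + 3) / 4 + c₀) * Ψ₀ + g₀)
    (hξℓ : ξ * ℓ ≤ 2 * (kR + 1)) (hθℓ : θ * ℓ ^ 2 ≤ D * P₀) (hθP : θ ≤ P₁) (hb₀ : |b₀| ≤ B₀)
    (hbc : (|b₁| / 2 + |c₀|) * θ ≤ δ / 4 * θ + M₁) :
    ν / 2 * (θ * Ψ₁ ^ 2) + 3 * δ / 8 * (θ * Ψ₀ ^ 2) ≤
      (M₁ + B₀ ^ 2 * D / (2 * δ) + ν * D / 2) * (P₀ * Ψ₀ ^ 2) + 2 / δ * (P₁ * g₀ ^ 2)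
      + ν * (θ * ℓ * Ψ₀ * Ψ₁ + θ * Ψ₁ ^ 2 + θ * Ψ₀ * Ψ₂)
      - 1 / 2 * ((1 / 2 + b₁) * θ * Ψ₀ ^ 2 + (ξ / 2 + b₀) * θ * ℓ * Ψ₀ ^ 2
          + 2 * (ξ / 2 + b₀) * θ * Ψ₀ * Ψ₁) := by
  have hθ0 := hθ.le
  have hθΨ : 0 ≤ θ * Ψ₀ ^ 2 := by positivity
  -- the equation, multiplied by `θΨ₀`
  have hEq' : θ * Ψ₀ * (ν * Ψ₂) =
      θ * Ψ₀ * ((ξ / 2 + b₀) * Ψ₁ + (δ + (2 * kR + 3) / 4 + c₀) * Ψ₀ + g₀) := by rw [hEq]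
  -- (p1) drift
  have p1 : ξ * ℓ * (θ * Ψ₀ ^ 2) ≤ 2 * (kR + 1) * (θ * Ψ₀ ^ 2) :=
    mul_le_mul_of_nonneg_right hξℓ hθΨ
  -- (p2) the small / compactly supported coefficients
  have p2 : (b₁ / 2 - c₀) * (θ * Ψ₀ ^ 2) ≤ (δ / 4 * θ + M₁) * Ψ₀ ^ 2 := by
    have h1 : b₁ / 2 - c₀ ≤ |b₁| / 2 + |c₀| := by
      linarith [le_abs_self b₁, neg_abs_le c₀]
    have h2 : (b₁ / 2 - c₀) * θ ≤ δ / 4 * θ + M₁ := (mul_le_mul_of_nonneg_right h1 hθ0).trans hbc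
    have h3 := mul_le_mul_of_nonneg_right h2 (sq_nonneg Ψ₀)
    linarith [h3]
  have p2' : M₁ * Ψ₀ ^ 2 ≤ M₁ * (P₀ * Ψ₀ ^ 2) := by
    have h := mul_le_mul_of_nonneg_left (mul_le_mul_of_nonneg_right hP₀ (sq_nonneg Ψ₀)) hM₁
    linarith [h]
  -- (p3) the bounded drift perturbation against `θ′`: AM-GM `b₀ℓ ≤ δ/4 + b₀²ℓ²/δ`
  have am : b₀ * ℓ ≤ δ / 4 + b₀ ^ 2 * ℓ ^ 2 / δ := by
    have hsq : 0 ≤ (b₀ * ℓ - δ / 2) ^ 2 / δ := by positivity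
    have hid : (b₀ * ℓ - δ / 2) ^ 2 / δ = δ / 4 + b₀ ^ 2 * ℓ ^ 2 / δ - b₀ * ℓ := by
      field_simp
      ring
    linarith [hsq, hid]
  have b0sq : b₀ ^ 2 ≤ B₀ ^ 2 := by
    obtain ⟨h1, h2⟩ := abs_le.mp hb₀
    nlinarith
  have p3 : b₀ * ℓ * (θ * Ψ₀ ^ 2) ≤ δ / 4 * (θ * Ψ₀ ^ 2) + B₀ ^ 2 * D / δ * (P₀ * Ψ₀ ^ 2) := by
    have hX : 0 ≤ ℓ ^ 2 / δ * (θ * Ψ₀ ^ 2) := by positivity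
    calc b₀ * ℓ * (θ * Ψ₀ ^ 2) ≤ (δ / 4 + b₀ ^ 2 * ℓ ^ 2 / δ) * (θ * Ψ₀ ^ 2) :=
          mul_le_mul_of_nonneg_right am hθΨ
      _ = δ / 4 * (θ * Ψ₀ ^ 2) + b₀ ^ 2 * (ℓ ^ 2 / δ * (θ * Ψ₀ ^ 2)) := by ring
      _ ≤ δ / 4 * (θ * Ψ₀ ^ 2) + B₀ ^ 2 * (ℓ ^ 2 / δ * (θ * Ψ₀ ^ 2)) := by
          have := mul_le_mul_of_nonneg_right b0sq hX
          linarith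
      _ = δ / 4 * (θ * Ψ₀ ^ 2) + B₀ ^ 2 / δ * Ψ₀ ^ 2 * (θ * ℓ ^ 2) := by ring
      _ ≤ δ / 4 * (θ * Ψ₀ ^ 2) + B₀ ^ 2 / δ * Ψ₀ ^ 2 * (D * P₀) := by
          have := mul_le_mul_of_nonneg_left hθℓ (show 0 ≤ B₀ ^ 2 / δ * Ψ₀ ^ 2 by positivity)
          linarith
      _ = δ / 4 * (θ * Ψ₀ ^ 2) + B₀ ^ 2 * D / δ * (P₀ * Ψ₀ ^ 2) := by ring
  -- (p4) the source term: AM-GM `|g₀Ψ₀| ≤ (δ/8)Ψ₀² + (2/δ)g₀²`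
  have p4 : -(g₀ * θ * Ψ₀) ≤ δ / 8 * (θ * Ψ₀ ^ 2) + 2 / δ * (P₁ * g₀ ^ 2) := by
    have hsq : 0 ≤ (δ * Ψ₀ + 4 * g₀) ^ 2 / (8 * δ) := by positivity
    have hid : (δ * Ψ₀ + 4 * g₀) ^ 2 / (8 * δ) = δ / 8 * Ψ₀ ^ 2 + 2 / δ * g₀ ^ 2 + g₀ * Ψ₀ := by
      field_simp
      ring
    have h2 : 0 ≤ θ * (δ / 8 * Ψ₀ ^ 2 + 2 / δ * g₀ ^ 2 + g₀ * Ψ₀) :=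
      mul_nonneg hθ0 (by linarith [hsq, hid])
    have h3 : 2 / δ * (θ * g₀ ^ 2) ≤ 2 / δ * (P₁ * g₀ ^ 2) :=
      mul_le_mul_of_nonneg_left (mul_le_mul_of_nonneg_right hθP (sq_nonneg g₀)) (by positivity)
    linarith [h2, h3]
  -- (p5) the `θ′ΨΨ′` cross term: Cauchy–Schwarz
  have p5 : -(ν * (θ * ℓ * Ψ₀ * Ψ₁)) ≤ ν / 2 * (θ * Ψ₁ ^ 2) + ν * D / 2 * (P₀ * Ψ₀ ^ 2) := by
    have h1 : 0 ≤ ν * θ * (ℓ * Ψ₀ + Ψ₁) ^ 2 := by positivity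
    have h2 : ν * Ψ₀ ^ 2 * (θ * ℓ ^ 2) ≤ ν * Ψ₀ ^ 2 * (D * P₀) :=
      mul_le_mul_of_nonneg_left hθℓ (by positivity)
    linarith [h1, h2]
  -- the exact bookkeeping identity (modulo the equation), then the nonnegative brackets
  have key_id :
      ((M₁ + B₀ ^ 2 * D / (2 * δ) + ν * D / 2) * (P₀ * Ψ₀ ^ 2) + 2 / δ * (P₁ * g₀ ^ 2)
        + ν * (θ * ℓ * Ψ₀ * Ψ₁ + θ * Ψ₁ ^ 2 + θ * Ψ₀ * Ψ₂)
        - 1 / 2 * ((1 / 2 + b₁) * θ * Ψ₀ ^ 2 + (ξ / 2 + b₀) * θ * ℓ * Ψ₀ ^ 2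
            + 2 * (ξ / 2 + b₀) * θ * Ψ₀ * Ψ₁))
        - (ν / 2 * (θ * Ψ₁ ^ 2) + 3 * δ / 8 * (θ * Ψ₀ ^ 2)) =
      1 / 4 * (2 * (kR + 1) * (θ * Ψ₀ ^ 2) - ξ * ℓ * (θ * Ψ₀ ^ 2))
        + ((δ / 4 * θ + M₁) * Ψ₀ ^ 2 - (b₁ / 2 - c₀) * (θ * Ψ₀ ^ 2))
        + (M₁ * (P₀ * Ψ₀ ^ 2) - M₁ * Ψ₀ ^ 2)
        + 1 / 2 * (δ / 4 * (θ * Ψ₀ ^ 2) + B₀ ^ 2 * D / δ * (P₀ * Ψ₀ ^ 2) - b₀ * ℓ * (θ * Ψ₀ ^ 2))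
        + (δ / 8 * (θ * Ψ₀ ^ 2) + 2 / δ * (P₁ * g₀ ^ 2) - -(g₀ * θ * Ψ₀))
        + (ν / 2 * (θ * Ψ₁ ^ 2) + ν * D / 2 * (P₀ * Ψ₀ ^ 2) - -(ν * (θ * ℓ * Ψ₀ * Ψ₁)))
        + δ / 8 * (θ * Ψ₀ ^ 2) := by
    linear_combination (θ * Ψ₀) * hEq
  have hslack : 0 ≤ δ / 8 * (θ * Ψ₀ ^ 2) := by positivity
  linarith [key_id, p1, p2, p2', p3, p4, p5, hslack]

/-- The coefficient bound fed to `key_pointwise`: if `|b′| ≤ B₁`, `|c| ≤ C₀` everywhere and `|b′|/2 + |c| ≤ δ/4` for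
`|ξ| ≥ R`, then for the weight `θ = gw k ε` (`ε ≥ 0`): `(|b′|/2 + |c|)θ ≤ (δ/4)θ + (B₁/2 + C₀)(1+R²)^{k+1}`. [folklore] -/
theorem coeff_bound {k : ℕ} {ε δ B₁ C₀ R b₁ c₀ ξ : ℝ} (hε : 0 ≤ ε) (hδ : 0 ≤ δ)
    (hB₁ : |b₁| ≤ B₁) (hC₀ : |c₀| ≤ C₀) (htail : R ≤ |ξ| → |b₁| / 2 + |c₀| ≤ δ / 4) :
    (|b₁| / 2 + |c₀|) * gw k ε ξ ≤ δ / 4 * gw k ε ξ + (B₁ / 2 + C₀) * (1 + R ^ 2) ^ (k + 1) := by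
  have hθ := (gw_pos (k := k) (ξ := ξ) hε).le
  have hBC : 0 ≤ B₁ / 2 + C₀ := by linarith [abs_nonneg b₁, abs_nonneg c₀]
  have hM : 0 ≤ (B₁ / 2 + C₀) * (1 + R ^ 2) ^ (k + 1) := by positivity
  rcases le_or_gt R |ξ| with hR | hR
  · have := mul_le_mul_of_nonneg_right (htail hR) hθ
    linarith
  · -- `|ξ| < R`: the weight is at most `(1+R²)^{k+1}`
    have h1 : gw k ε ξ ≤ (1 + R ^ 2) ^ (k + 1) := by
      refine (gw_le_pow hε).trans (pow_le_pow_left₀ (one_add_sq_pos ξ).le ?_ _)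
      have : ξ ^ 2 ≤ R ^ 2 := by
        have h := abs_nonneg ξ
        nlinarith [sq_abs ξ, hR]
      linarith
    have h2 : (|b₁| / 2 + |c₀|) * gw k ε ξ ≤ (B₁ / 2 + C₀) * (1 + R ^ 2) ^ (k + 1) :=
      mul_le_mul (by linarith) h1 hθ hBC
    nlinarith [mul_nonneg hδ hθ]

end SheetRGainWeights
end Summit.NavierStokesRegularity.OSWSelfSimilar

end
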